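import Summits.QuantumFields.YangMills.Theorems.FluctuationComparisonRegPrIntLOrganTangentGaugeConjugateProbe
import Summits.QuantumFields.YangMills.Theorems.FluctuationComparisonRegPrIntLOrganTangentSmallStepWindowPath
import Literature.MathematicalPhysics.QuantumFieldTheory.Balaban1983to89.T4HaarSU2Translate
import Literature.MathematicalPhysics.QuantumFieldTheory.Balaban1983to89.T4WilsonLinkAffine
import Summits.QuantumFields.YangMills.Theorems.FluctuationComparisonRegPrIntLS2BetaWhitneyHatLiftRelative
import HarnessLib

/-!
# Crux `FluctuationComparisonRegPrIntL` (stmt-QuantumFields-20520, rung R3), PATH-B organ — (L50a) «`SU(2)` RIGHT EXPONENTIAL INCREMENTS»: the Lie-group bookkeeping behind the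
# D0 chart letters of RULING №56 (4) (LEAD w3 g28): a GLOBAL logarithm with a linear `dist1` bound, the exponential map is `1`-Lipschitz on `𝔰𝔲(2)` (Duhamel), hence
# ADDITIVE increments of Lie-algebra coordinates are MULTIPLICATIVE right increments, right increments of the two factors of a product `A·e^{U}` COMPOSE, and the rows of a
# relational square are one-bond right-exponential paths (with an `Ad`-rotated direction when the two coarse bonds coincide)

Cell `ym3-torus` (YM ladder rung R3 = continuum `SU(2)` Yang–Mills on the three-torus — a RUNG: NOT d = 4, NOT infinite volume, NOT a mass gap, NOT Clay).
Width seat `ym-ust-20520-w5` (gen 25), `--kind proof --supports stmt-QuantumFields-20520 --as helper`, count-neutral, DEFINITION-FREE, default heartbeats,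
no registry ∕ binder ∕ `Lines/` edit.  Over ✓`…OrganTangentGaugeConjugateProbe` (`conj_expPt`, `norm_adVec_le`, `norm_toE_le`, `norm_ofLp_le`),
✓`…OrganTangentSmallStepWindowPath` (`expPt_add_smul`), lit ✓`T4ExpWindowSmallField` (`logVec`, `expPoint_logVec`, `dist1_eq_two_mul_sin`, `dist1_eq_norm_su2Quat_sub_one`, `dist1_expPt_le`),
lit ✓`T4HaarSU2Translate` (`su2Quat_mul`), lit ✓`T4WilsonLinkAffine` (`su2Quat_inv`), ✓`…S2BetaWhitneyHatLiftRelative` (`norm_exp_imQuat_sub_exp_imQuat_le_norm_sub`: `exp` is `1`-Lipschitz on `𝔰𝔲(2)`).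

INHABITATION (★★OWNER RULING №100): no analytic letter in this file — [folklore] Lie-group facts about `SU(2)`, law-free.

WHAT.  §1 `exists_expPt_eq_norm_le_dist1` — every `g ∈ SU(2)` is `expPt w` with `‖w‖_sup ≤ (π∕2)·dist1 g` (global quaternion logarithm + Jordan's inequality).
§2 `dist1_expPt_inv_mul_expPt_le` — `dist1 (e^{−u}e^{u′}) ≤ √3·‖u′ − u‖_sup`;
`exists_expPt_eq_expPt_mul` — ADDITIVE ⟹ MULTIPLICATIVE: `e^{u′} = e^{u}·e^{c}`, `‖c‖ ≤ (π∕2)·√3·‖u′ − u‖`.  §3 `exists_rightIncr_comp` — `A′ = A e^{a}`, `e^{U′} = e^{U}e^{c}` ⟹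
`A′e^{U′} = (A e^{U})·e^{w}`, `‖w‖ ≤ (π∕2)·√3·(√3‖a‖ + ‖c‖)`.  §4 `relSquare_row_step` — on a relational square `X` over `(V00; B, m; B′, m′)`: `X s″ s′` is `X s s′` moved at the ONE
bond `B` by `expPt u`, `‖u‖ ≤ √3·|s″ − s|·‖m‖`, and the interpolants `update (X s s′) B (X s s′ B·expPt (r•u))` are `X (s + r(s″ − s)) s′`; `relPath_step` — the same for paths.

HONEST FRAMING: [folklore] `SU(2)` bookkeeping; nothing of Bałaban's analysis is asserted or proved; no row of `OrganDischargeInputsHJ(sq)` ∕ `SpreadFibreLawH(J)(sq)` is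
discharged here; the five registered stubs of `Lines/semiclassical_s2beta.lean`, crux 20520 and `YM3TorusSU2` are NOT proved; registry untouched; rung R3 = SU(2) YM₃ on T³ —
NOT d = 4, NOT infinite volume, NOT a mass gap, NOT Clay; the Yang–Mills mass gap is NOT proved.  [folklore]
-/

set_option autoImplicit false

noncomputable section

namespace Summit.QuantumFields.YangMills.Theorems.OrganTangentSU2RightIncrements

open Function NormedSpace
open Literature.MathematicalPhysics.QuantumLattice (su2Quat norm_su2Quat)
open Literature.MathematicalPhysics.QuantumFieldTheory
open Literature.MathematicalPhysics.QuantumFieldTheory.Balaban1983to89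
open T4CubeChartGnomonic (SU2)
open T4HaarSU2ExpChart (expPoint imQuat norm_imQuat norm_exp_imQuat su2Quat_expPoint)
open T4CubeChartExp (toE expPt expPt_zero)
open T4ExpWindowSmallField (logVec norm_logVec_le_pi expPoint_logVec dist1_eq_two_mul_sin dist1_eq_norm_su2Quat_sub_one dist1_expPt_le)
open T4HaarSU2Translate (su2Quat_mul)
open T4WilsonLinkAffine (su2Quat_inv)
open B15Prop1ChartSU2 (adSU2)
open Summit.QuantumFields.YangMills.Theorems.OrganTangentGaugeConjugateProbe (toE_ofLp conj_expPt norm_adVec_le norm_toE_le norm_ofLp_le)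
open Summit.QuantumFields.YangMills.Theorems.OrganTangentSmallStepWindowPath (expPt_add_smul)
open Summit.QuantumFields.YangMills.Theorems.FluctuationComparisonRegPrIntLS2BetaWhitneyHatLiftRelative (norm_exp_imQuat_sub_exp_imQuat_le_norm_sub)

/-! ## §1 The global logarithm with a linear `dist1` bound -/

/-- ★ **GLOBAL LOG**: every `g ∈ SU(2)` is `expPt w` with `‖w‖_sup ≤ (π∕2)·dist1 g` (`w :=` the quaternion logarithm; `dist1 g = 2 sin(‖log‖∕2) ≥ (2∕π)‖log‖` by Jordan,
`‖log‖ ≤ π`). [folklore] -/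
theorem exists_expPt_eq_norm_le_dist1 (g : SU2) : ∃ w : Fin 3 → ℝ, expPt w = g ∧ ‖w‖ ≤ Real.pi / 2 * dist1 g := by
  refine ⟨WithLp.ofLp (logVec (su2Quat g)), ?_, ?_⟩
  · rw [expPt, toE_ofLp]; exact expPoint_logVec g
  · have hθπ : ‖logVec (su2Quat g)‖ ≤ Real.pi := norm_logVec_le_pi _
    have hθ0 : 0 ≤ ‖logVec (su2Quat g)‖ := norm_nonneg _
    have hj : 2 / Real.pi * (‖logVec (su2Quat g)‖ / 2) ≤ Real.sin (‖logVec (su2Quat g)‖ / 2) :=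
      Real.mul_le_sin (by positivity) (by linarith)
    have hsup : ‖WithLp.ofLp (logVec (su2Quat g))‖ ≤ ‖logVec (su2Quat g)‖ := norm_ofLp_le _
    have hπ := Real.pi_pos
    rw [dist1_eq_two_mul_sin]
    refine hsup.trans ?_
    have h2 : ‖logVec (su2Quat g)‖ / Real.pi ≤ Real.sin (‖logVec (su2Quat g)‖ / 2) := by
      calc ‖logVec (su2Quat g)‖ / Real.pi = 2 / Real.pi * (‖logVec (su2Quat g)‖ / 2) := by ring
        _ ≤ _ := hj
    calc ‖logVec (su2Quat g)‖ = Real.pi * (‖logVec (su2Quat g)‖ / Real.pi) := by field_simp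
      _ ≤ Real.pi * Real.sin (‖logVec (su2Quat g)‖ / 2) := mul_le_mul_of_nonneg_left h2 hπ.le
      _ = Real.pi / 2 * (2 * Real.sin (‖logVec (su2Quat g)‖ / 2)) := by ring

/-! ## §2 The exponential map is `1`-Lipschitz on `𝔰𝔲(2)`; additive ⟹ multiplicative increments -/

/-- `dist1 (e^{−u}·e^{u′}) ≤ √3·‖u′ − u‖_sup`. [folklore] -/
theorem dist1_expPt_inv_mul_expPt_le (u u' : Fin 3 → ℝ) : dist1 ((expPt u)⁻¹ * expPt u') ≤ Real.sqrt 3 * ‖u' - u‖ := by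
  rw [dist1_eq_norm_su2Quat_sub_one, su2Quat_mul, su2Quat_inv, expPt, expPt, su2Quat_expPoint, su2Quat_expPoint]
  have h1 : star (exp (imQuat (toE u))) * exp (imQuat (toE u)) = 1 := by
    rw [Quaternion.star_mul_self, Quaternion.normSq_eq_norm_mul_self, norm_exp_imQuat, mul_one, Quaternion.coe_one]
  calc ‖star (exp (imQuat (toE u))) * exp (imQuat (toE u')) - 1‖
      = ‖star (exp (imQuat (toE u))) * (exp (imQuat (toE u')) - exp (imQuat (toE u)))‖ := by rw [mul_sub, h1]
    _ = ‖exp (imQuat (toE u')) - exp (imQuat (toE u))‖ := by rw [norm_mul, norm_star, norm_exp_imQuat, one_mul]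
    _ ≤ ‖toE u' - toE u‖ := norm_exp_imQuat_sub_exp_imQuat_le_norm_sub _ _
    _ = ‖toE (u' - u)‖ := rfl
    _ ≤ Real.sqrt 3 * ‖u' - u‖ := norm_toE_le _

/-- ★ **ADDITIVE ⟹ MULTIPLICATIVE**: `e^{u′} = e^{u}·e^{c}` with `‖c‖ ≤ (π∕2)·(√3·‖u′ − u‖)`. [folklore] -/
theorem exists_expPt_eq_expPt_mul (u u' : Fin 3 → ℝ) : ∃ c : Fin 3 → ℝ, expPt u' = expPt u * expPt c ∧ ‖c‖ ≤ Real.pi / 2 * (Real.sqrt 3 * ‖u' - u‖) := by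
  obtain ⟨c, hc, hcle⟩ := exists_expPt_eq_norm_le_dist1 ((expPt u)⁻¹ * expPt u')
  exact ⟨c, by rw [hc, mul_inv_cancel_left], hcle.trans (mul_le_mul_of_nonneg_left (dist1_expPt_inv_mul_expPt_le u u') (by positivity))⟩

/-! ## §3 Right increments of the two factors of `A·e^{U}` compose -/

/-- ★★ **COMPOSITION**: `A′ = A·e^{a}` and `e^{U′} = e^{U}·e^{c}` ⟹ `A′·e^{U′} = (A·e^{U})·e^{w}` with `‖w‖ ≤ (π∕2)·(√3·(√3‖a‖ + ‖c‖))`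
(`e^{−U}e^{a}e^{U} = e^{Ad a}`, `‖Ad a‖_sup ≤ √3‖a‖_sup`, `dist1` subadditive, `dist1 (e^{v}) ≤ √3‖v‖`, then the global log). [folklore] -/
theorem exists_rightIncr_comp (A A' : SU2) (U U' a c : Fin 3 → ℝ) (hA : A' = A * expPt a) (hU : expPt U' = expPt U * expPt c) :
    ∃ w : Fin 3 → ℝ, A' * expPt U' = A * expPt U * expPt w ∧ ‖w‖ ≤ Real.pi / 2 * (Real.sqrt 3 * (Real.sqrt 3 * ‖a‖ + ‖c‖)) := by
  have hconj : (expPt U)⁻¹ * expPt a * expPt U = expPt (WithLp.ofLp (adSU2 (expPt U)⁻¹ (toE a))) := by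
    rw [← conj_expPt, inv_inv]
  obtain ⟨w, hw, hwle⟩ := exists_expPt_eq_norm_le_dist1 (expPt (WithLp.ofLp (adSU2 (expPt U)⁻¹ (toE a))) * expPt c)
  refine ⟨w, ?_, hwle.trans (mul_le_mul_of_nonneg_left ?_ (by positivity))⟩
  · rw [hA, hU, hw, ← hconj]; group
  · calc dist1 (expPt (WithLp.ofLp (adSU2 (expPt U)⁻¹ (toE a))) * expPt c)
        ≤ dist1 (expPt (WithLp.ofLp (adSU2 (expPt U)⁻¹ (toE a)))) + dist1 (expPt c) := GaugeGroup.dist1_mul_le _ _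
      _ ≤ Real.sqrt 3 * ‖WithLp.ofLp (adSU2 (expPt U)⁻¹ (toE a))‖ + Real.sqrt 3 * ‖c‖ :=
          add_le_add ((dist1_expPt_le _).trans (norm_toE_le _)) ((dist1_expPt_le _).trans (norm_toE_le _))
      _ ≤ Real.sqrt 3 * (Real.sqrt 3 * ‖a‖) + Real.sqrt 3 * ‖c‖ := by
          have := norm_adVec_le (expPt U)⁻¹ a
          nlinarith [Real.sqrt_nonneg 3]
      _ = Real.sqrt 3 * (Real.sqrt 3 * ‖a‖ + ‖c‖) := by ring

/-! ## §4 Rows of a relational square and points of a relational path are one-bond right-exponential moves -/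

section Relational

variable {P : Params} {j : ℕ}

/-- ★ **PATH STEP**: on a relational path `X` (`X s = U₂` off `B′`, `X s B′ = U₂ B′·expPt (s•m′)`), `X s′` is `X s` moved at `B′` by `expPt ((s′ − s)•m′)`, and the interpolants
`update (X s) B′ (X s B′·expPt (r•((s′ − s)•m′)))` are the path points `X (s + r(s′ − s))`. [folklore] -/
theorem relPath_step (B' : PBond P j) (m' : Fin 3 → ℝ) (U₂ : GaugeField P j SU2) (X : ℝ → GaugeField P j SU2)
    (hoff : ∀ s e, e ≠ B' → X s e = U₂ e) (hon : ∀ s, X s B' = U₂ B' * expPt (s • m')) (s s' : ℝ) :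
    (∀ e, e ≠ B' → X s' e = X s e) ∧ X s' B' = X s B' * expPt ((s' - s) • m') ∧ ‖(s' - s) • m'‖ ≤ Real.sqrt 3 * (|s' - s| * ‖m'‖) ∧
      ∀ r : ℝ, update (X s) B' (X s B' * expPt (r • ((s' - s) • m'))) = X (s + r * (s' - s)) := by
  refine ⟨fun e he => by rw [hoff s' e he, hoff s e he], ?_, ?_, fun r => ?_⟩
  · rw [hon, hon, mul_assoc, ← expPt_add_smul, add_sub_cancel]
  · rw [norm_smul, Real.norm_eq_abs]
    exact le_mul_of_one_le_left (by positivity) (by rw [show (1:ℝ) = Real.sqrt 1 from Real.sqrt_one.symm]; exact Real.sqrt_le_sqrt (by norm_num))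
  · funext e
    by_cases he : e = B'
    · subst he
      rw [update_self, hon, hon, smul_smul, mul_assoc, ← expPt_add_smul]
    · rw [update_of_ne he, hoff s e he, hoff _ e he]

/-- ★★ **SQUARE-ROW STEP**: on a relational square `X` over `(V00; B, m; B′, m′)` (`Y s = V00` off `B`, `Y s B = V00 B·expPt (s•m)`, `X s s′ = Y s` off `B′`,
`X s s′ B′ = Y s B′·expPt (s′•m′)`), for fixed `s′` the point `X s″ s′` is `X s s′` moved at the ONE bond `B` by `expPt u` with `‖u‖ ≤ √3·|s″ − s|·‖m‖`, and the interpolants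
`update (X s s′) B (X s s′ B·expPt (r•u))` are `X (s + r(s″ − s)) s′` — in BOTH cases `B ≠ B′` (`u = (s″ − s)•m`) and `B = B′` (`u = Ad_{e^{−s′m′}} ((s″ − s)•m)`). [folklore] -/
theorem relSquare_row_step (B B' : PBond P j) (m m' : Fin 3 → ℝ) (V00 : GaugeField P j SU2) (Y : ℝ → GaugeField P j SU2) (X : ℝ → ℝ → GaugeField P j SU2)
    (hYoff : ∀ s e, e ≠ B → Y s e = V00 e) (hYon : ∀ s, Y s B = V00 B * expPt (s • m)) (hXoff : ∀ s s' e, e ≠ B' → X s s' e = Y s e)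
    (hXon : ∀ s s', X s s' B' = Y s B' * expPt (s' • m')) (s s'' s' : ℝ) :
    ∃ u : Fin 3 → ℝ, (∀ e, e ≠ B → X s'' s' e = X s s' e) ∧ X s'' s' B = X s s' B * expPt u ∧ ‖u‖ ≤ Real.sqrt 3 * (|s'' - s| * ‖m‖) ∧
      ∀ r : ℝ, update (X s s') B (X s s' B * expPt (r • u)) = X (s + r * (s'' - s)) s' := by
  -- off `B` the rows agree
  have hoffB : ∀ σ σ' e, e ≠ B → X σ' s' e = X σ s' e := by
    intro σ σ' e he
    by_cases he' : e = B'
    · subst he'; rw [hXon, hXon, hYoff σ' _ he, hYoff σ _ he]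
    · rw [hXoff σ' s' e he', hXoff σ s' e he', hYoff σ' e he, hYoff σ e he]
  by_cases hB : B = B'
  · -- the two coarse bonds coincide: rotate the direction by `Ad_{e^{−s′m′}}`
    subst hB
    set g : SU2 := (expPt (s' • m'))⁻¹ with hg
    have hrow : ∀ σ, X σ s' B = V00 B * expPt (σ • m) * expPt (s' • m') := fun σ => by rw [hXon, hYon]
    have hconj : ∀ v : Fin 3 → ℝ, expPt (s' • m') * expPt (WithLp.ofLp (adSU2 g (toE v))) = expPt v * expPt (s' • m') := by
      intro v
      rw [← conj_expPt, hg, inv_inv, ← mul_assoc, ← mul_assoc, mul_inv_cancel, one_mul]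
    -- the row point `σ + d` from the row point `σ`, for any displacement `d`
    have hstep : ∀ σ d : ℝ, X (σ + d) s' B = X σ s' B * expPt (WithLp.ofLp (adSU2 g (toE (d • m)))) := by
      intro σ d
      calc X (σ + d) s' B = V00 B * (expPt (σ • m) * expPt (d • m)) * expPt (s' • m') := by rw [hrow, expPt_add_smul]
        _ = V00 B * expPt (σ • m) * (expPt (d • m) * expPt (s' • m')) := by simp only [mul_assoc]
        _ = V00 B * expPt (σ • m) * (expPt (s' • m') * expPt (WithLp.ofLp (adSU2 g (toE (d • m))))) := by rw [hconj]
        _ = X σ s' B * expPt (WithLp.ofLp (adSU2 g (toE (d • m)))) := by rw [hrow]; simp only [mul_assoc]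
    refine ⟨WithLp.ofLp (adSU2 g (toE ((s'' - s) • m))), fun e he => hoffB s s'' e he, ?_, ?_, fun r => ?_⟩
    · rw [← hstep, add_sub_cancel]
    · refine (norm_adVec_le g _).trans ?_
      rw [norm_smul, Real.norm_eq_abs]
    · funext e
      by_cases he : e = B
      · subst he
        have hlin : r • WithLp.ofLp (adSU2 g (toE ((s'' - s) • m))) = WithLp.ofLp (adSU2 g (toE ((r * (s'' - s)) • m))) := by
          rw [← smul_smul, show toE (r • ((s'' - s) • m)) = r • toE ((s'' - s) • m) from rfl, map_smul]; rfl
        rw [update_self, hlin, hstep]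
      · rw [update_of_ne he]; exact (hoffB s (s + r * (s'' - s)) e he).symm
  · -- distinct coarse bonds: the row is a plain one-bond path at `B`
    have hrow : ∀ σ, X σ s' B = V00 B * expPt (σ • m) := fun σ => by rw [hXoff σ s' B hB, hYon]
    refine ⟨(s'' - s) • m, fun e he => hoffB s s'' e he, ?_, ?_, fun r => ?_⟩
    · rw [hrow, hrow, mul_assoc, ← expPt_add_smul, add_sub_cancel]
    · rw [norm_smul, Real.norm_eq_abs]
      exact le_mul_of_one_le_left (by positivity) (by rw [show (1:ℝ) = Real.sqrt 1 from Real.sqrt_one.symm]; exact Real.sqrt_le_sqrt (by norm_num))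
    · funext e
      by_cases he : e = B
      · subst he
        rw [update_self, hrow, hrow, smul_smul, mul_assoc, ← expPt_add_smul]
      · rw [update_of_ne he]; exact (hoffB s (s + r * (s'' - s)) e he).symm

end Relational

end Summit.QuantumFields.YangMills.Theorems.OrganTangentSU2RightIncrements

end
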